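import Literature.Geometry.Lorentzian.TameFamilyOffCompact

/-!
# Relative tameness transfer off a compact set (registered stub `stub_tameOfAgreeOffCompact`,
line `Sketch` = unwind-the-threshold-from-scri, crux `PhotonSphereChannels.TameCensorship`,
item stmt-FinalStateConjecture-17431)

A jointly smooth one-parameter family `F` of initial data whose members agree, off ONE compact
set `K ⊆ X`, member by member with a family `G` that is TAME on the asymptotically flat end `e`
(`InitialDataSet.IsTameDataFamily`: jointly smooth, `e` sole, continuous mass `M (c)`,
`wDist`-continuity at the base parameter) is itself tame on the collared restriction
`e.restrict _` of `e` at the radius `R₁ = max R₀ e.R + 1`, where `R₀` is a radius beyond which the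
far regions of `e` miss `K` (`AFEnd.exists_forall_far_disjoint`). This is the relative version of
`InitialDataSet.isTameDataFamily_restrict_of_agree_off_compact` (`TameFamilyOffCompact.lean`, the
case `G` constant), used by the gauge shear of the line: the sections of `F c` and `G c` agree on
`e.far R₀`, so their chart components agree beyond `max R₀ e.R` (`AFEnd.hCoeff_eq_of_agree_far`,
`AFEnd.kCoeff_eq_of_agree_far`); soleness and Dafermos–Rodnianski decay with the SAME masses
`M (c)` pass to the collar (`AFEnd.isSoleEnd_restrict_iff`,
`AFEnd.isStronglyAsymptoticallyFlatDR_restrict_iff`,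
`AFEnd.IsStronglyAsymptoticallyFlatDR.congr_of_eqOn_far`); and on the collar the weighted distance
`wDist (F c) (F 0)` EQUALS `wDist (G c) (G 0)` (by `AFEnd.wDist_restrict_eq` both are `iSup`s over
`R₁ < ‖x‖` of iterated derivatives of differences of chart components, which coincide near every
such `x`, and `iteratedFDeriv` is local) and the latter is at most `e.wDist (G c) (G 0) → 0`
(the `iSup` over the smaller region `R₁ < ‖x‖ ⊆ e.R < ‖x‖`).
Stub-worker of the line lead prover-line-stmt-FinalStateConjecture-17431-0, 2026-08-17.
-/

-- the summit-side namespace `Summit.FinalStateConjecture.FinalStateConjecture.…` (summit = problem)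
-- repeats a component by design, which the `dupNamespace` linter would flag on every decl.
set_option linter.dupNamespace false

noncomputable section

open Literature.Geometry.Lorentzian
open scoped Manifold ContDiff Topology ENNReal
open Filter Set Function

namespace Summit.FinalStateConjecture.FinalStateConjecture.Theorems.PhotonSphereChannels.TameCensorshipUnwind

variable {X : Type} [TopologicalSpace X] [ChartedSpace E3 X] [IsManifold (𝓡 3) ∞ X]

/-- Restricting an end does not increase the weighted distance: by `AFEnd.wDist_restrict_eq` the
distance on `e.restrict _` is the same pair of weighted `iSup`s of the chart components of `e`,
run over the smaller region `R₁ < ‖x‖ ⊆ e.R < ‖x‖`. -/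
private theorem wDist_restrict_le_wDist (e : AFEnd X) {R₁ : ℝ} (hR₁ : e.R ≤ R₁)
    (D D' : InitialDataSet (𝓡 3) X) : (e.restrict hR₁).wDist D D' ≤ e.wDist D D' := by
  rw [e.wDist_restrict_eq hR₁ D D']
  unfold AFEnd.wDist
  gcongr with m hm x <;> exact iSup_mono' fun hx ↦ ⟨lt_of_le_of_lt hR₁ hx, le_rfl⟩

/-- Two pairs of data whose chart components on `e` agree beyond a radius `R' < R₁` have the same
weighted distance on the collared end `e.restrict _` of radius `R₁`: the `iSup`s of
`AFEnd.wDist_restrict_eq` run over `R₁ < ‖x‖`, where the differences of chart components agree on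
the open neighbourhood `{R' < ‖y‖}` of `x`, so their `iteratedFDeriv`s at `x` agree
(`Filter.EventuallyEq.iteratedFDeriv`). -/
private theorem wDist_restrict_congr_of_coeff (e : AFEnd X) {R' R₁ : ℝ} (hR₁ : e.R ≤ R₁)
    (hR' : R' < R₁) {D₁ D₁' D₂ D₂' : InitialDataSet (𝓡 3) X}
    (hh : ∀ y : E3, R' < ‖y‖ → e.hCoeff D₁ y = e.hCoeff D₂ y)
    (hh' : ∀ y : E3, R' < ‖y‖ → e.hCoeff D₁' y = e.hCoeff D₂' y)
    (hk : ∀ y : E3, R' < ‖y‖ → e.kCoeff D₁ y = e.kCoeff D₂ y)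
    (hk' : ∀ y : E3, R' < ‖y‖ → e.kCoeff D₁' y = e.kCoeff D₂' y) :
    (e.restrict hR₁).wDist D₁ D₁' = (e.restrict hR₁).wDist D₂ D₂' := by
  rw [e.wDist_restrict_eq hR₁, e.wDist_restrict_eq hR₁]
  have hopen : IsOpen {y : E3 | R' < ‖y‖} := isOpen_lt continuous_const continuous_norm
  congr 1
  · refine iSup_congr fun m ↦ iSup_congr fun _ ↦ iSup_congr fun x ↦ iSup_congr fun hx ↦ ?_
    have hev : (fun y ↦ e.hCoeff D₁ y - e.hCoeff D₁' y) =ᶠ[𝓝 x]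
        fun y ↦ e.hCoeff D₂ y - e.hCoeff D₂' y := by
      filter_upwards [hopen.mem_nhds (show R' < ‖x‖ from hR'.trans hx)] with y hy
      rw [hh y hy, hh' y hy]
    rw [(hev.iteratedFDeriv ℝ m).eq_of_nhds]
  · refine iSup_congr fun m ↦ iSup_congr fun _ ↦ iSup_congr fun x ↦ iSup_congr fun hx ↦ ?_
    have hev : (fun y ↦ e.kCoeff D₁ y - e.kCoeff D₁' y) =ᶠ[𝓝 x]
        fun y ↦ e.kCoeff D₂ y - e.kCoeff D₂' y := by
      filter_upwards [hopen.mem_nhds (show R' < ‖x‖ from hR'.trans hx)] with y hy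
      rw [hk y hy, hk' y hy]
    rw [(hev.iteratedFDeriv ℝ m).eq_of_nhds]

/-- **Relative tameness transfer off a compact set** (registered stub `stub_tameOfAgreeOffCompact`
of the line `Sketch` of the crux `PhotonSphereChannels.TameCensorship`): a jointly smooth
one-parameter family `F` whose members agree, off ONE compact set `K`, with the members of a
family `G` TAME on the end `e` is itself tame on some collared restriction `e.restrict _` of `e`
(same sole end, the masses `M (c)` of `G`, `wDist`-continuity read beyond a radius missing `K`,
where the chart components of `F c` and `G c` coincide). Proof: with `R₀` from
`AFEnd.exists_forall_far_disjoint` (far regions of `e` missing `K`) the sections of `F c` and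
`G c` agree on `e.far R₀`, hence their chart components agree beyond `max R₀ e.R`
(`AFEnd.hCoeff_eq_of_agree_far` / `kCoeff_eq_of_agree_far`); take `R₁ := max R₀ e.R + 1`.
Soleness: `AFEnd.isSoleEnd_restrict_iff`; decay with mass `M (c)`:
`AFEnd.isStronglyAsymptoticallyFlatDR_restrict_iff` and
`AFEnd.IsStronglyAsymptoticallyFlatDR.congr_of_eqOn_far`; `wDist`: on the collar
`wDist (F c) (F 0) = wDist (G c) (G 0) ≤ e.wDist (G c) (G 0) → 0` (locality of `iteratedFDeriv`
and monotonicity of the `iSup` in the region), squeezed against the constant `0`. -/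
theorem stub_tameOfAgreeOffCompact :
    ∀ (X : Type) [TopologicalSpace X] [ChartedSpace E3 X] [IsManifold (𝓡 3) ∞ X]
      (e : AFEnd X) (F G : EuclideanSpace ℝ (Fin 1) → InitialDataSet (𝓡 3) X) (K : Set X),
      IsCompact K → InitialDataSet.IsSmoothDataFamily 1 F → InitialDataSet.IsTameDataFamily e 1 G →
      (∀ c, ∀ x ∉ K, (F c).h.inner x = (G c).h.inner x ∧ (F c).k x = (G c).k x) →
      ∃ (R₁ : ℝ) (hR₁ : e.R ≤ R₁), InitialDataSet.IsTameDataFamily (e.restrict hR₁) 1 F := by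
  intro X _ _ _ e F G K hK hF hG hagree
  -- a far region of `e` missing `K`, on which the members of `F` and `G` agree
  obtain ⟨R₀, hR₀⟩ := e.exists_forall_far_disjoint hK
  have hfarK : ∀ q ∈ e.far R₀, q ∉ K :=
    fun q hq hqK ↦ Set.disjoint_left.1 (hR₀ R₀ le_rfl) hq hqK
  have hagree_far : ∀ c, ∀ q ∈ e.far R₀,
      (F c).h.inner q = (G c).h.inner q ∧ (F c).k q = (G c).k q :=
    fun c q hq ↦ hagree c q (hfarK q hq)
  -- hence the chart components agree beyond `max R₀ e.R`
  have hh : ∀ (c : EuclideanSpace ℝ (Fin 1)) (y : E3), max R₀ e.R < ‖y‖ →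
      e.hCoeff (F c) y = e.hCoeff (G c) y :=
    fun c y hy ↦ e.hCoeff_eq_of_agree_far (fun q hq ↦ (hagree_far c q hq).1) hy
  have hk : ∀ (c : EuclideanSpace ℝ (Fin 1)) (y : E3), max R₀ e.R < ‖y‖ →
      e.kCoeff (F c) y = e.kCoeff (G c) y :=
    fun c y hy ↦ e.kCoeff_eq_of_agree_far (fun q hq ↦ (hagree_far c q hq).2) hy
  -- the collar radius
  have hR₁e : e.R ≤ max R₀ e.R + 1 := by
    have := le_max_right R₀ e.R
    linarith
  have hR'lt : max R₀ e.R < max R₀ e.R + 1 := lt_add_one _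
  obtain ⟨-, hsole, ⟨M, hMc, hSAF⟩, hlim⟩ := hG
  refine ⟨max R₀ e.R + 1, hR₁e, hF, (e.isSoleEnd_restrict_iff hR₁e).2 hsole,
    ⟨M, hMc, fun c ↦ ?_⟩, ?_⟩
  · -- decay of each member on the collared end, with the mass of the corresponding member of `G`
    rw [e.isStronglyAsymptoticallyFlatDR_restrict_iff hR₁e]
    exact (hSAF c).congr_of_eqOn_far (R₀ := R₀) (fun q hq ↦ (hagree_far c q hq).1)
      (fun q hq ↦ (hagree_far c q hq).2)
  · -- `wDist`-continuity at the base parameter, squeezed between `0` and `e.wDist (G c) (G 0)`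
    refine tendsto_of_tendsto_of_tendsto_of_le_of_le tendsto_const_nhds hlim
      (fun _ ↦ zero_le) fun c ↦ ?_
    change (e.restrict hR₁e).wDist (F c) (F 0) ≤ e.wDist (G c) (G 0)
    rw [wDist_restrict_congr_of_coeff e hR₁e hR'lt (hh c) (hh 0) (hk c) (hk 0)]
    exact wDist_restrict_le_wDist e hR₁e _ _

end Summit.FinalStateConjecture.FinalStateConjecture.Theorems.PhotonSphereChannels.TameCensorshipUnwind

end
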